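import Literature.MathematicalPhysics.QuantumManyBody.JelliumSection5Identifications
import HarnessLib

/-!
# Assembly of Lieb–Solovej §5 in first quantization, I: the summed pair bound and the one-`Q` group

Topic `Literature/MathematicalPhysics/QuantumManyBody` (the charged Bose gas, `JelliumBoseGas.foldyLaw`).
First two steps of the assembly of [LiebSolovej2001, §5] (the lower bound of the potential part of
`H^n_{ℓ,r,R}` by its "quadratic" part plus controlled errors) for a continuous `n`-body function on
`Λⁿ = cellN` and a symmetric bounded weight `0 ≤ w ≤ W_b` with row integrals `≤ M`:

* `col_bound_of_symm`, `integrableOn_w_conj_mul` — bookkeeping;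
* `sum_pair_lowerBound` — `pair_lowerBound` (`JelliumPairLowerBound`) summed over ordered pairs:
  `∑_{i≠j}∫w(xᵢ,xⱼ)|Ψ|² ≥ ∑_{i≠j}[D₀+D₁+D₂+2(R₀₁+R₀₂+R₀₃) - (1+ε⁻¹)ℓ⁻³M(‖PᵢQⱼΨ‖²+‖QᵢPⱼΨ‖²)]`;
* `oneQ_group_lowerBound` — the one-`Q` group after the regrouping `∑_{i≠j}(R₀₁+R₀₂) = 2∑ⱼ∑_{i≠j}R₀₁`
  (`JelliumSection5Identifications`) and [LiebSolovej2001, Lemma 5.5] (`JelliumLemma55.ls_lemma55`):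
  `4∑ⱼ(∑_{i≠j}R₀₁^{(i,j)} - ρ∫m(xⱼ)Re(conj(PⱼΨ)QⱼΨ)) ≥ -2∑ⱼ(εℓ⁻³(∫m)‖Aⱼ‖² + ε⁻¹∫m(xⱼ)|QⱼΨ|²)`.

## References

* [LiebSolovej2001] E. H. Lieb, J. P. Solovej, Commun. Math. Phys. 217 (2001) 127–163, §5, Lemma 5.5.
-/

noncomputable section

open MeasureTheory Set Filter Real
open scoped ENNReal NNReal Topology ComplexConjugate

namespace Literature.MathematicalPhysics.QuantumManyBody.JelliumBoseGas

open BoseGas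

variable {n : ℕ} {ℓ : ℝ}

/-- For a symmetric weight the column integrals obey the row bound. [folklore] -/
theorem col_bound_of_symm {w : Space → Space → ℝ} (hsymm : ∀ x y, w x y = w y x) {M : ℝ≥0∞}
    (hrow : ∀ x, ∫⁻ y in cell ℓ, ENNReal.ofReal (w x y) ≤ M) (y : Space) :
    ∫⁻ x in cell ℓ, ENNReal.ofReal (w x y) ≤ M := by
  simp_rw [hsymm _ y]; exact hrow y

/-- Products `w(xᵢ,xⱼ)·conj(F)·G` with `w` bounded measurable and `F, G` continuous are integrable on `Λⁿ`.
[folklore] -/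
theorem integrableOn_w_conj_mul {w : Space → Space → ℝ} (hw : Measurable (Function.uncurry w)) {Wb : ℝ}
    (hWb : ∀ x y, |w x y| ≤ Wb) (i j : Fin n) {F G : Config n → ℂ} (hF : Continuous F) (hG : Continuous G) :
    IntegrableOn (fun X => (w (X i) (X j) : ℂ) * (conj (F X) * G X)) (cellN n ℓ) := by
  have hvol : volume (cellN n ℓ) ≠ ⊤ := by
    rw [volume_cellN]; exact ENNReal.pow_ne_top (ENNReal.pow_ne_top ENNReal.ofReal_ne_top)
  have hwij : Measurable fun X : Config n => w (X i) (X j) := by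
    have e : (fun X : Config n => w (X i) (X j)) = Function.uncurry w ∘ fun X : Config n => (X i, X j) := rfl
    rw [e]; exact hw.comp (by fun_prop)
  obtain ⟨CF, hCF⟩ := (isCompact_closedCubeN n ℓ).exists_bound_of_continuousOn hF.continuousOn
  obtain ⟨CG, hCG⟩ := (isCompact_closedCubeN n ℓ).exists_bound_of_continuousOn hG.continuousOn
  have hWb0 : 0 ≤ Wb := (abs_nonneg _).trans (hWb 0 0)
  have hmeas : Measurable fun X : Config n => (w (X i) (X j) : ℂ) * (conj (F X) * G X) :=
    (Complex.measurable_ofReal.comp hwij).mul ((Complex.continuous_conj.measurable.comp hF.measurable).mul hG.measurable)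
  refine Measure.integrableOn_of_bounded (M := Wb * (CF * CG)) hvol hmeas.aestronglyMeasurable ?_
  refine (ae_restrict_iff' (measurableSet_cellN _ _)).2 (Eventually.of_forall fun X hX => ?_)
  rw [norm_mul, Complex.norm_real, Real.norm_eq_abs, norm_mul, Complex.norm_conj]
  exact mul_le_mul (hWb _ _) (mul_le_mul (hCF X (cellN_subset_closedCubeN _ _ hX))
    (hCG X (cellN_subset_closedCubeN _ _ hX)) (norm_nonneg _)
      ((norm_nonneg _).trans (hCF X (cellN_subset_closedCubeN _ _ hX))))
    (mul_nonneg (norm_nonneg _) (norm_nonneg _)) hWb0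

/-- **The pair term summed over ordered pairs, lower bound** (`pair_lowerBound` summed):
`∑ᵢ∑_{j≠i}∫w(xᵢ,xⱼ)|Ψ|² ≥ ∑ᵢ∑_{j≠i}[D₀+D₁+D₂+2(R₀₁+R₀₂+R₀₃) - (1+ε⁻¹)ℓ⁻³M(‖pc 1‖²+‖pc 2‖²)]`
for a symmetric weight `0 ≤ w ≤ W_b` with row integrals `≤ M < ∞`, continuous `Ψ`, `0 < ε ≤ ½`.
[cite: LiebSolovej2001, Lemmas 5.4–5.6] -/
theorem sum_pair_lowerBound (hℓ : 0 < ℓ) {w : Space → Space → ℝ} (hw : Measurable (Function.uncurry w))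
    (hw0 : ∀ x y, 0 ≤ w x y) {Wb : ℝ} (hWb : ∀ x y, |w x y| ≤ Wb) (hsymm : ∀ x y, w x y = w y x)
    {M : ℝ≥0∞} (hM : M ≠ ⊤) (hrow : ∀ x, ∫⁻ y in cell ℓ, ENNReal.ofReal (w x y) ≤ M)
    {Ψ : Config n → ℂ} (hΨ : Continuous Ψ) {ε : ℝ} (hε : 0 < ε) (hε2 : ε ≤ 1 / 2) :
    ∑ i : Fin n, ∑ j ∈ Finset.univ.erase i,
      ((∫ X in cellN n ℓ, w (X i) (X j) * ‖condensatePieces ℓ i j Ψ 0 X‖ ^ 2) +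
        (∫ X in cellN n ℓ, w (X i) (X j) * ‖condensatePieces ℓ i j Ψ 1 X‖ ^ 2) +
        (∫ X in cellN n ℓ, w (X i) (X j) * ‖condensatePieces ℓ i j Ψ 2 X‖ ^ 2) +
        2 * ((∫ X in cellN n ℓ, w (X i) (X j) *
                (conj (condensatePieces ℓ i j Ψ 0 X) * condensatePieces ℓ i j Ψ 1 X).re) +
             (∫ X in cellN n ℓ, w (X i) (X j) *
                (conj (condensatePieces ℓ i j Ψ 0 X) * condensatePieces ℓ i j Ψ 2 X).re) +
             (∫ X in cellN n ℓ, w (X i) (X j) *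
                (conj (condensatePieces ℓ i j Ψ 0 X) * condensatePieces ℓ i j Ψ 3 X).re)) -
        (1 + ε⁻¹) * ((ℓ ^ 3)⁻¹ * M.toReal) *
          ((∫⁻ X in cellN n ℓ, (‖condensatePieces ℓ i j Ψ 1 X‖₊ : ℝ≥0∞) ^ 2).toReal +
            (∫⁻ X in cellN n ℓ, (‖condensatePieces ℓ i j Ψ 2 X‖₊ : ℝ≥0∞) ^ 2).toReal)) ≤
      ∑ i : Fin n, ∑ j ∈ Finset.univ.erase i, ∫ X in cellN n ℓ, w (X i) (X j) * ‖Ψ X‖ ^ 2 := by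
  refine Finset.sum_le_sum fun i _ => Finset.sum_le_sum fun j hj => ?_
  exact pair_lowerBound hℓ (Finset.ne_of_mem_erase hj).symm hw hw0 hWb hM hrow (col_bound_of_symm hsymm hrow)
    hΨ hε hε2

/-- **The one-`Q` group** [LiebSolovej2001, Lemma 5.5 summed over the particles]: for `n+1` particles,
a symmetric bounded measurable weight `0 ≤ w ≤ W_b` with `m(x) = ∫_Λw(y,x)dy`, continuous `Ψ`, `ρ ∈ ℝ`
and `ε > 0`,
`4∑ⱼ(∑_{i≠j}∫wRe(conj(PᵢPⱼΨ)PᵢQⱼΨ) - ρ∫m(xⱼ)Re(conj(PⱼΨ)QⱼΨ)) ≥ -2∑ⱼ(εℓ⁻³(∫m)‖Aⱼ‖² + ε⁻¹∫m(xⱼ)|QⱼΨ|²)`,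
`Aⱼ = ℓ⁻³∑_{i≠j}PᵢPⱼΨ - ρPⱼΨ`. [cite: LiebSolovej2001, Lemma 5.5] -/
theorem oneQ_group_lowerBound (hℓ : 0 < ℓ) {w : Space → Space → ℝ} (hw : Measurable (Function.uncurry w))
    (hw0 : ∀ x y, 0 ≤ w x y) {Wb : ℝ} (hWb : ∀ x y, |w x y| ≤ Wb) {Ψ : Config (n + 1) → ℂ}
    (hΨ : Continuous Ψ) (ρ : ℝ) {ε : ℝ} (hε : 0 < ε) :
    -(2 * ∑ j : Fin (n + 1), (ε * ((ℓ ^ 3)⁻¹ * (∫ y in cell ℓ, ∫ y' in cell ℓ, w y' y) *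
          (∫⁻ X in cellN (n + 1) ℓ, (‖(((ℓ ^ 3)⁻¹ : ℝ) : ℂ) *
            (∑ i ∈ Finset.univ.erase j, sliceMean ℓ i (sliceMean ℓ j Ψ) X) -
              (ρ : ℂ) * sliceMean ℓ j Ψ X‖₊ : ℝ≥0∞) ^ 2).toReal) +
        ε⁻¹ * (∫⁻ X in cellN (n + 1) ℓ, ENNReal.ofReal (∫ y in cell ℓ, w y (X j)) *
          (‖sliceFluct ℓ j Ψ X‖₊ : ℝ≥0∞) ^ 2).toReal)) ≤
      4 * ∑ j : Fin (n + 1), ((∑ i ∈ Finset.univ.erase j, ∫ X in cellN (n + 1) ℓ, w (X i) (X j) *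
          (conj (sliceMean ℓ i (sliceMean ℓ j Ψ) X) * sliceMean ℓ i (sliceFluct ℓ j Ψ) X).re) -
        ρ * ∫ X in cellN (n + 1) ℓ, (∫ y in cell ℓ, w y (X j)) *
          (conj (sliceMean ℓ j Ψ X) * sliceFluct ℓ j Ψ X).re) := by
  obtain ⟨hmm, hm0, hmb⟩ := column_weight_props hℓ.le hw hw0 hWb
  rw [Finset.mul_sum, Finset.mul_sum, ← Finset.sum_neg_distrib]
  refine Finset.sum_le_sum fun j _ => ?_
  have h := ls_lemma55 hℓ j hw hw0 hWb hΨ ρ hε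
  -- complex versus real forms of the blocks
  have hP : Continuous (sliceMean ℓ j Ψ) := continuous_sliceMean ℓ j hΨ
  have hQ : Continuous (sliceFluct ℓ j Ψ) := continuous_sliceFluct ℓ j hΨ
  have e1 : (∑ i ∈ Finset.univ.erase j, ∫ X in cellN (n + 1) ℓ, (w (X i) (X j) : ℂ) *
      (conj (sliceMean ℓ i (sliceMean ℓ j Ψ) X) * sliceMean ℓ i (sliceFluct ℓ j Ψ) X)).re =
      ∑ i ∈ Finset.univ.erase j, ∫ X in cellN (n + 1) ℓ, w (X i) (X j) *
        (conj (sliceMean ℓ i (sliceMean ℓ j Ψ) X) * sliceMean ℓ i (sliceFluct ℓ j Ψ) X).re := by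
    rw [Complex.re_sum]
    refine Finset.sum_congr rfl fun i _ => ?_
    exact re_integral_ofReal_mul (integrableOn_w_conj_mul hw hWb i j
      (continuous_sliceMean ℓ i hP) (continuous_sliceMean ℓ i hQ))
  have e2 : (∫ X in cellN (n + 1) ℓ, ((∫ y in cell ℓ, w y (X j) : ℝ) : ℂ) *
      (conj (sliceMean ℓ j Ψ X) * sliceFluct ℓ j Ψ X)).re =
      ∫ X in cellN (n + 1) ℓ, (∫ y in cell ℓ, w y (X j)) * (conj (sliceMean ℓ j Ψ X) * sliceFluct ℓ j Ψ X).re :=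
    re_integral_ofReal_mul (integrableOn_weight_conj_mul hmm hmb j hP hQ)
  rw [e1, e2] at h
  have h' := (abs_le.1 h).1
  linarith

end Literature.MathematicalPhysics.QuantumManyBody.JelliumBoseGas
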